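import Summits.ResolutionOfSingularities.ResolutionOfSingularities.Theorems.FrobeniusLadderFInjectiveMacaulayficationWeightedConeCore
import Summits.ResolutionOfSingularities.ResolutionOfSingularities.Theorems.FrobeniusLadderFInjectiveMacaulayficationOnExceptionalDeform
import Summits.ResolutionOfSingularities.ResolutionOfSingularities.Theorems.FrobeniusLadderFInjectiveMacaulayficationQuotLocalizationIso
import Summits.ResolutionOfSingularities.ResolutionOfSingularities.Theorems.FrobeniusLadderFInjectiveMacaulayficationIsoLocusTransport
import Mathlib.RingTheory.Localization.LocalizationLocalization
import Mathlib.RingTheory.Polynomial.Quotient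
import Mathlib.RingTheory.Polynomial.Basic
import HarnessLib

/-!
# The clause on the exceptional fibre of the extended Rees algebra `(R[1/u])[s]`, `u = x̄_v^c`
# (crux `FInjectiveMacaulayfication`, line `graded-engine`, §16 helper H-G4a = G4 assembly step 2)

Support file for crux stmt-ResolutionOfSingularities-15315 (`FrobeniusLadder.FInjectiveMacaulayfication`), §16 THE GRADED
ENGINE (CRUX-PLAN w45a v3, line `graded-engine`, registered stub G4 `stub_gradedChartClause`; design memo GRADED-ENGINE.md v2
step (iii), lead seat res-L1-w45a-lead-1; `GradedChartClausePlan.lean` "G4 assembly" step 2). [OURS · L1 W4.5a] — bookkeeping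
over landed route lemmas; not a statement of any manuscript; AI-written, weaker than expert review.

Setting: `k` a field of characteristic `p`, `R = k[X₁, …, Xₙ]/(f)` with `(f)` prime, a variable `x̄_v ≠ 0` and `c > 0`,
`L = R[1/x̄_v^c]`, `T' = L[s]` (Mathlib `Polynomial L`; in the graded engine `T'` is the extended Rees algebra of the weight
filtration and `s = t⁻¹` cuts out the exceptional fibre). HYPOTHESIS `hoff`: `R` satisfies the per-stalk clause of the crux
(every system of parameters weakly regular, every parameter ideal Frobenius closed) at its maximal ideals missing some variable.
CONCLUSION (`exceptionalFibreClause`): at every prime `P ∋ s` of `T'` the local ring `T'_P` is a domain satisfying the clause —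
the `hclB` input of `FiniteGradedDescent.stub_finiteGradedDescent` (p173797) with `B := T'`, `b := s`.

Proof.
* `clause_atPrime_away` — every local ring of `L` at a prime `P'` satisfies the full clause: `L_{P'} ≅ R_{P''}` for
  `P'' = P' ∩ R` (Mathlib `IsLocalization.localizationLocalizationAtPrimeIsoLocalization`), `x̄_v ∉ P''` (`x̄_v^c` is a unit
  of `L`), so `P''` lies in a maximal ideal `Q` missing some variable (Jacobson: `WeightedConeCore.exists_maximal_not_mem_X`
  with the ideal `(x̄_v)`), and the clause descends from `R_Q` to `R_{P''}` (`ClauseOfMaximal.fiClause_atPrime_of_le`) and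
  transports along the ring isomorphism (`IsoLocusTransport.bundledClause_of_ringEquiv`).
* `clause_polynomial_atPrime_of_X_mem` — abstract: for a Noetherian domain `L` of characteristic `p` all of whose local rings
  satisfy the clause, and a prime `P ∋ X` of `L[X]`, the local ring `L[X]_P` is a domain satisfying the clause: by the
  DEFORMATION step E1 (`OnExceptionalDeform.stub_onExceptionalDeform`, p136373; Fedder 1983 Thm. 3.4 (1)) applied to the
  non-zero-divisor `X`, it suffices that `L[X]_P/(X)` satisfies the clause, and `L[X]_P/(X) ≅ (L[X]/(X))_{P/(X)} ≅ L_{P'}`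
  (`QuotLocalizationIso.stub_quotLocalizationIso` p136400, `Polynomial.quotientSpanXSubCAlgEquiv 0`,
  `BlowupFiModelOfCover.nonempty_ringEquiv_localization_of_ringEquiv`, `DegreeZeroDescent.inlineClause_of_ringEquiv`).
* `exceptionalFibreClause` — the two combined (`L = R[1/x̄_v^c]` is a Noetherian domain of characteristic `p`).

## References

* R. Fedder, *F-purity and rational singularity*, Trans. AMS 278 (1983), Thm. 3.4 (1) (deformation). [Fedder1983]
* folklore (localization bookkeeping).
-/

set_option linter.dupNamespace false

noncomputable section

open Polynomial Literature.AlgebraicGeometry.Resolution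

namespace Summit.ResolutionOfSingularities.ResolutionOfSingularities.Theorems.FInjectiveMacaulayfication.ExceptionalFibreClause

/-- **Deformation across the fibre `X = 0` of `L[X]`.** Let `L` be a Noetherian domain of characteristic `p` all of whose
local rings at primes are domains satisfying the clause (every system of parameters weakly regular, every parameter ideal
Frobenius closed). Then for every prime `P` of `L[X]` containing `X`, the local ring `L[X]_P` is a domain satisfying the
clause: `X/1` is a non-zero-divisor in the maximal ideal with `L[X]_P/(X) ≅ L_{P ∩ L}`, and the clause deforms
(E1, `OnExceptionalDeform.stub_onExceptionalDeform`). [cite: Fedder1983, Thm. 3.4 (1)]; folklore. -/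
theorem clause_polynomial_atPrime_of_X_mem (p : ℕ) [Fact p.Prime] (L : Type) [CommRing L] [IsDomain L]
    [IsNoetherianRing L] [CharP L p]
    (hL : ∀ (P' : Ideal L) [P'.IsPrime], IsDomain (Localization.AtPrime P') ∧
      ∀ d : ℕ, ringKrullDim (Localization.AtPrime P') = d → ∀ s : Fin d → Localization.AtPrime P',
        (Ideal.span (Set.range s)).radical.IsMaximal →
          RingTheory.Sequence.IsWeaklyRegular (Localization.AtPrime P') (List.ofFn s) ∧
          ∀ y : Localization.AtPrime P', (∃ e : ℕ, y ^ p ^ e ∈ Ideal.span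
            ((fun z : Localization.AtPrime P' => z ^ p ^ e) ''
              (Ideal.span (Set.range s) : Set (Localization.AtPrime P')))) → y ∈ Ideal.span (Set.range s))
    (P : Ideal L[X]) [P.IsPrime] (hXP : (X : L[X]) ∈ P) :
    IsDomain (Localization.AtPrime P) ∧
      ∀ d : ℕ, ringKrullDim (Localization.AtPrime P) = d → ∀ s : Fin d → Localization.AtPrime P,
        (Ideal.span (Set.range s)).radical.IsMaximal →
          RingTheory.Sequence.IsWeaklyRegular (Localization.AtPrime P) (List.ofFn s) ∧
          ∀ y : Localization.AtPrime P, (∃ e : ℕ, y ^ p ^ e ∈ Ideal.span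
            ((fun z : Localization.AtPrime P => z ^ p ^ e) ''
              (Ideal.span (Set.range s) : Set (Localization.AtPrime P)))) → y ∈ Ideal.span (Set.range s) := by
  refine OnExceptionalDeform.stub_onExceptionalDeform p L[X] X Polynomial.X_ne_zero P hXP ?_
  -- `Q' = P/(X)`, a prime of `L[X]/(X)` pulling back to `P`
  have hker : RingHom.ker (Ideal.Quotient.mk (Ideal.span {(X : L[X])})) ≤ P := by
    rw [Ideal.mk_ker]
    exact (Ideal.span_singleton_le_iff_mem _).mpr hXP
  haveI hQ' : (P.map (Ideal.Quotient.mk (Ideal.span {(X : L[X])}))).IsPrime :=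
    Ideal.map_isPrime_of_surjective Ideal.Quotient.mk_surjective hker
  have hQ'c : (P.map (Ideal.Quotient.mk (Ideal.span {(X : L[X])}))).comap
      (Ideal.Quotient.mk (Ideal.span {(X : L[X])})) = P := by
    rw [Ideal.comap_map_of_surjective _ Ideal.Quotient.mk_surjective, ← RingHom.ker_eq_comap_bot]
    exact sup_eq_left.mpr hker
  obtain ⟨e₁⟩ := QuotLocalizationIso.stub_quotLocalizationIso L[X] X P
    (P.map (Ideal.Quotient.mk (Ideal.span {(X : L[X])}))) hQ'c
  -- `L[X]/(X) ≅ L` (evaluation at `0`)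
  have hspan : Ideal.span {(X : L[X])} = Ideal.span {X - C (0 : L)} := by rw [map_zero, sub_zero]
  obtain ⟨e, -⟩ : ∃ e : (L[X] ⧸ Ideal.span {(X : L[X])}) ≃+* L, True :=
    ⟨(Ideal.quotEquivOfEq hspan).trans (Polynomial.quotientSpanXSubCAlgEquiv (0 : L)).toRingEquiv, trivial⟩
  -- `P' ⊆ L`, the prime corresponding to `Q'` under `e`
  obtain ⟨P', hP'⟩ : ∃ P' : Ideal L,
      P' = (P.map (Ideal.Quotient.mk (Ideal.span {(X : L[X])}))).comap e.symm.toRingHom := ⟨_, rfl⟩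
  haveI : P'.IsPrime := by rw [hP']; infer_instance
  obtain ⟨e₂⟩ := BlowupFiModelOfCover.nonempty_ringEquiv_localization_of_ringEquiv e
    (P.map (Ideal.Quotient.mk (Ideal.span {(X : L[X])}))) P' (fun x => by
      rw [hP', Ideal.mem_comap]
      simp)
  exact DegreeZeroDescent.inlineClause_of_ringEquiv p (e₁.trans e₂).symm (hL P').2

/-- **Every local ring of `L = R[1/x̄_v^c]` satisfies the full clause** (`R = k[X]/(f)`, `(f)` prime, `c > 0`; if `x̄_v = 0`
then `L = 0` has no primes and the statement is vacuous;
`hoff` = the clause at the maximal ideals of `R` missing some variable): `L_{P'} ≅ R_{P' ∩ R}` with `x̄_v ∉ P' ∩ R`, and a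
prime missing `x̄_v` lies in a maximal ideal missing some variable (`R` is Jacobson), from which the clause descends.
[folklore] -/
theorem clause_atPrime_away (p : ℕ) [Fact p.Prime] (k : Type) [Field k] [CharP k p] (n : ℕ)
    (f : MvPolynomial (Fin n) k) (hfprime : (Ideal.span {f}).IsPrime) (v : Fin n) (c : ℕ) (hc : 0 < c)
    (hoff : ∀ (Q : Ideal (MvPolynomial (Fin n) k ⧸ Ideal.span {f})) [Q.IsMaximal],
      (∃ j : Fin n, Ideal.Quotient.mk (Ideal.span {f}) (MvPolynomial.X j) ∉ Q) →
      ∀ d : ℕ, ringKrullDim (Localization.AtPrime Q) = d → ∀ s : Fin d → Localization.AtPrime Q,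
        (Ideal.span (Set.range s)).radical.IsMaximal →
          RingTheory.Sequence.IsWeaklyRegular (Localization.AtPrime Q) (List.ofFn s) ∧
          ∀ y : Localization.AtPrime Q, (∃ e : ℕ, y ^ p ^ e ∈ Ideal.span
            ((fun z : Localization.AtPrime Q => z ^ p ^ e) ''
              (Ideal.span (Set.range s) : Set (Localization.AtPrime Q)))) → y ∈ Ideal.span (Set.range s))
    (P' : Ideal (Localization.Away (Ideal.Quotient.mk (Ideal.span {f}) (MvPolynomial.X v) ^ c))) [P'.IsPrime] :
    IsDomain (Localization.AtPrime P') ∧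
      ∀ d : ℕ, ringKrullDim (Localization.AtPrime P') = d → ∀ s : Fin d → Localization.AtPrime P',
        (Ideal.span (Set.range s)).radical.IsMaximal →
          RingTheory.Sequence.IsWeaklyRegular (Localization.AtPrime P') (List.ofFn s) ∧
          ∀ y : Localization.AtPrime P', (∃ e : ℕ, y ^ p ^ e ∈ Ideal.span
            ((fun z : Localization.AtPrime P' => z ^ p ^ e) ''
              (Ideal.span (Set.range s) : Set (Localization.AtPrime P')))) → y ∈ Ideal.span (Set.range s) := by
  haveI := hfprime
  haveI : IsDomain (MvPolynomial (Fin n) k ⧸ Ideal.span {f}) := Ideal.Quotient.isDomain _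
  haveI : CharP (MvPolynomial (Fin n) k ⧸ Ideal.span {f}) p :=
    charP_of_injective_algebraMap (algebraMap k (MvPolynomial (Fin n) k ⧸ Ideal.span {f})).injective p
  -- the contraction `P'' = P' ∩ R` misses `x̄_v` (`x̄_v^c` is a unit of `L`)
  obtain ⟨P'', hP''⟩ : ∃ P'' : Ideal (MvPolynomial (Fin n) k ⧸ Ideal.span {f}),
      P'' = P'.comap (algebraMap (MvPolynomial (Fin n) k ⧸ Ideal.span {f})
        (Localization.Away (Ideal.Quotient.mk (Ideal.span {f}) (MvPolynomial.X v) ^ c))) := ⟨_, rfl⟩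
  haveI : P''.IsPrime := by rw [hP'']; infer_instance
  have hvP'' : Ideal.Quotient.mk (Ideal.span {f}) (MvPolynomial.X v) ∉ P'' := by
    intro h
    have huP'' : Ideal.Quotient.mk (Ideal.span {f}) (MvPolynomial.X v) ^ c ∈ P'' := Ideal.pow_mem_of_mem P'' h c hc
    rw [hP'', Ideal.mem_comap] at huP''
    exact (Ideal.IsPrime.ne_top inferInstance) (Ideal.eq_top_of_isUnit_mem _ huP''
      (IsLocalization.Away.algebraMap_isUnit
        (S := Localization.Away (Ideal.Quotient.mk (Ideal.span {f}) (MvPolynomial.X v) ^ c))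
        (Ideal.Quotient.mk (Ideal.span {f}) (MvPolynomial.X v) ^ c)))
  -- Jacobson: a maximal ideal `Q ⊇ P''` missing some variable
  have hIle : Ideal.span {Ideal.Quotient.mk (Ideal.span {f}) (MvPolynomial.X v)} ≤
      Ideal.span (Set.range fun j : Fin n => Ideal.Quotient.mk (Ideal.span {f}) (MvPolynomial.X j)) :=
    (Ideal.span_singleton_le_iff_mem _).mpr (Ideal.subset_span (Set.mem_range_self v))
  have hIP : ¬ Ideal.span {Ideal.Quotient.mk (Ideal.span {f}) (MvPolynomial.X v)} ≤ P'' := fun h =>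
    hvP'' ((Ideal.span_singleton_le_iff_mem _).mp h)
  obtain ⟨Q, hQ, hPQ, j, hj⟩ := WeightedConeCore.exists_maximal_not_mem_X f _ hIle P'' hIP
  haveI := hQ
  have hR := ClauseOfMaximal.fiClause_atPrime_of_le p hPQ ⟨inferInstance, hoff Q ⟨j, hj⟩⟩
  -- transport along `R_{P''} ≅ L_{P'}`
  have e : Localization.AtPrime P'' ≃+* Localization.AtPrime P' := by
    subst hP''
    exact (IsLocalization.localizationLocalizationAtPrimeIsoLocalization
      (Submonoid.powers (Ideal.Quotient.mk (Ideal.span {f}) (MvPolynomial.X v) ^ c)) P').toRingEquiv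
  exact IsoLocusTransport.bundledClause_of_ringEquiv p e hR

/-- **H-G4a `exceptionalFibreClause` (G4 assembly step 2).** `k` a field of characteristic `p`, `R = k[X₁, …, Xₙ]/(f)` with
`(f)` prime, `x̄_v ≠ 0`, `c > 0`, and `R` satisfying the clause at its maximal ideals missing some variable. Then at every prime
`P ∋ s` of `T' = (R[1/x̄_v^c])[s]` the local ring `T'_P` is a domain in which every system of parameters is weakly regular and
generates a Frobenius closed ideal — the `hclB` input of `FiniteGradedDescent.stub_finiteGradedDescent` for `B := T'`,
`b := s`. [cite: Fedder1983, Thm. 3.4 (1)]; folklore. -/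
theorem exceptionalFibreClause (p : ℕ) [Fact p.Prime] (k : Type) [Field k] [CharP k p] (n : ℕ)
    (f : MvPolynomial (Fin n) k) (hfprime : (Ideal.span {f}).IsPrime) (v : Fin n) (c : ℕ) (hc : 0 < c)
    (hXv : Ideal.Quotient.mk (Ideal.span {f}) (MvPolynomial.X v) ≠ 0)
    (hoff : ∀ (Q : Ideal (MvPolynomial (Fin n) k ⧸ Ideal.span {f})) [Q.IsMaximal],
      (∃ j : Fin n, Ideal.Quotient.mk (Ideal.span {f}) (MvPolynomial.X j) ∉ Q) →
      ∀ d : ℕ, ringKrullDim (Localization.AtPrime Q) = d → ∀ s : Fin d → Localization.AtPrime Q,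
        (Ideal.span (Set.range s)).radical.IsMaximal →
          RingTheory.Sequence.IsWeaklyRegular (Localization.AtPrime Q) (List.ofFn s) ∧
          ∀ y : Localization.AtPrime Q, (∃ e : ℕ, y ^ p ^ e ∈ Ideal.span
            ((fun z : Localization.AtPrime Q => z ^ p ^ e) ''
              (Ideal.span (Set.range s) : Set (Localization.AtPrime Q)))) → y ∈ Ideal.span (Set.range s))
    (P : Ideal (Polynomial (Localization.Away (Ideal.Quotient.mk (Ideal.span {f}) (MvPolynomial.X v) ^ c))))
    [P.IsPrime]
    (hXP : (Polynomial.X : Polynomial (Localization.Away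
      (Ideal.Quotient.mk (Ideal.span {f}) (MvPolynomial.X v) ^ c))) ∈ P) :
    IsDomain (Localization.AtPrime P) ∧
      ∀ d : ℕ, ringKrullDim (Localization.AtPrime P) = d → ∀ s : Fin d → Localization.AtPrime P,
        (Ideal.span (Set.range s)).radical.IsMaximal →
          RingTheory.Sequence.IsWeaklyRegular (Localization.AtPrime P) (List.ofFn s) ∧
          ∀ y : Localization.AtPrime P, (∃ e : ℕ, y ^ p ^ e ∈ Ideal.span
            ((fun z : Localization.AtPrime P => z ^ p ^ e) ''
              (Ideal.span (Set.range s) : Set (Localization.AtPrime P)))) → y ∈ Ideal.span (Set.range s) := by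
  haveI := hfprime
  haveI : IsDomain (MvPolynomial (Fin n) k ⧸ Ideal.span {f}) := Ideal.Quotient.isDomain _
  haveI : CharP (MvPolynomial (Fin n) k ⧸ Ideal.span {f}) p :=
    charP_of_injective_algebraMap (algebraMap k (MvPolynomial (Fin n) k ⧸ Ideal.span {f})).injective p
  have hu : Ideal.Quotient.mk (Ideal.span {f}) (MvPolynomial.X v) ^ c ≠ 0 := pow_ne_zero _ hXv
  haveI : IsDomain (Localization.Away (Ideal.Quotient.mk (Ideal.span {f}) (MvPolynomial.X v) ^ c)) :=
    IsLocalization.isDomain_localization (powers_le_nonZeroDivisors_of_noZeroDivisors hu)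
  haveI : CharP (Localization.Away (Ideal.Quotient.mk (Ideal.span {f}) (MvPolynomial.X v) ^ c)) p :=
    charP_of_injective_algebraMap (IsLocalization.injective (Localization.Away _)
      (powers_le_nonZeroDivisors_of_noZeroDivisors hu)) p
  exact clause_polynomial_atPrime_of_X_mem p _ (fun P' _ => clause_atPrime_away p k n f hfprime v c hc hoff P') P hXP

end Summit.ResolutionOfSingularities.ResolutionOfSingularities.Theorems.FInjectiveMacaulayfication.ExceptionalFibreClause

end
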